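import Summits.SmoothPoincare4.SmoothPoincare4.Theorems.CylinderEntropyCylinderRungTwoLiminfDensityAlongGoodTimes
import Summits.SmoothPoincare4.SmoothPoincare4.Theorems.CylinderEntropyCylinderRungTwoAtomOfLiminfDensity
import Summits.SmoothPoincare4.SmoothPoincare4.Theorems.CylinderEntropyCylinderRungTwoLimitMeasureExists
import Summits.SmoothPoincare4.SmoothPoincare4.Theorems.CylinderEntropyCylinderRungTwoProductTestLimit
import Summits.SmoothPoincare4.SmoothPoincare4.Theorems.CylinderEntropyCylinderRungTwoEquidistribution
import Summits.SmoothPoincare4.SmoothPoincare4.Theorems.CylinderEntropyCylinderRungTwoDissipationBudget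
import Summits.SmoothPoincare4.SmoothPoincare4.Theorems.CylinderEntropyCylinderRungTwoAreaToFloorOfQuantization
import Summits.SmoothPoincare4.SmoothPoincare4.Theorems.CylinderEntropyCylinderRungTwoKernelMassOfProduct
import Literature.Geometry.Riemannian.SphericalCylinderEntropy
import Mathlib.Topology.Sequences
import HarnessLib

/-!
# Route `CylinderEntropy`, crux `CylinderRungTwo` (stmt-SmoothPoincare4-7631), line `killing-flux`:
# uniqueness of the limit height along good times of a thin cylinder flow
# (registered helper `helper_limitHeightUnique`; lead c4, "relaxation up to multiplicity",
# worker A4a)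

Along a smooth mean curvature flow `IsCylinderMCF M F ν T` of closed embedded cross-sections of
`N = S⁴ × ℝ ⊂ ℝ⁶` with thin slices, `λ_cyl(M_t) < 2` for `t ≥ T`, let `t k ≥ T + 1` be a monotone
sequence of GOOD TIMES: the window dissipations `∫⁻_{[t_k-1,t_k]} ∫⁻ ‖∂_r F‖² d((F r)^* μH⁴) dr → 0`
and the slice energies `∫⁻ ‖∂_r F(t_k, ·)‖² d((F (t k))^* μH⁴) → 0`.  If the heights of two sequences
of points of the slices converge, `(F (t k) (x k))₅ → c` and `(F (t k) (x' k))₅ → c'`, then `c = c'`.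

Proof (Allard-free; everything below is landed machinery of the line).
1. By the dissipation budget restarted at `t k` (`IsCylinderMCF.of_le`, `IsCylinderMCF.dissipationBudget`)
   the areas `a k = μH⁴(M_{t_k})` are antitone, hence converge to `A = ⨅ a k`, and
   `A ≤ a 0 < 2 vol(S⁴)` by `λ_cyl(M_{t_0}) < 2` (`IsCylinderMCF.measure_range_lt_two_mul`).
2. Eventually `a k ≤ A + 1`; after a shift, sequential Prokhorov (`helper_limitMeasureExists`) gives a
   subsequence `φ` along which `μH⁴ ⌊ M_{t_k} ⇀ μ`, a finite measure of mass `A` carried by the slab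
   `N ∩ {|z₅| ≤ B}` (`B` the uniform height bound of the flow, `exists_abs_apply_five_le`).
3. The slice energies are the Willmore energies (`‖∂_r F‖² = H²`, `IsCylinderMCF.norm_deriv_sq_eq`), so
   the product-test identities pass to the limit (`helper_productTestLimit`) and `μ` has the PRODUCT
   property (`helper_equidistribution`).
4. Every limit height `c` of points `F (t k) (x k)` is an atom of `μ` of weight `≥ vol(S⁴)`
   (`LimitHeightUnique.sphere_le_measure_slice_of_tendsto`): the centres `y k = F (t k) (x k)` lie in
   the compact slab, so a further subsequence converges to some `y₀` with `(y₀)₅ = c`; along it the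
   slices have unit lower density at their own points (`helper_liminfDensityAlongGoodTimes`, the window
   dissipations still tend to `0`), and `helper_atomOfLiminfDensity` gives `vol(S⁴) ≤ μ {z₅ = c}`.
5. If `c ≠ c'`, the two height slices are disjoint, so `2 vol(S⁴) ≤ μ {z₅ = c} + μ {z₅ = c'} ≤ μ(ℝ⁶)
   = A < 2 vol(S⁴)`, a contradiction.

Everything here is PROVED (no `sorry`, no definitions, no named facts).

References: K. A. Brakke, *The motion of a surface by its mean curvature* (1978), §3 (densities and
mass bounds of limit measures along the flow); R. S. Hamilton, Comm. Anal. Geom. 1 (1993) 127–137.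
-/

-- the prescribed namespace `Summit.SmoothPoincare4.SmoothPoincare4.…` repeats `SmoothPoincare4`
set_option linter.dupNamespace false

noncomputable section

open Bundle Set Function Filter MeasureTheory Module
open scoped Manifold ContDiff Topology RealInnerProductSpace BigOperators ENNReal NNReal

namespace Summit.SmoothPoincare4.SmoothPoincare4.Cruxes.CylinderRungTwo.KillingFlux

open Literature.Geometry.Riemannian Literature.Geometry.Riemannian.EuclideanHypersurface
open Literature.Geometry.Lorentzian Literature.Geometry.Lorentzian.PseudoRiemannianMetric
open Literature.Geometry.Riemannian.SphericalCylinderEntropy (cylKernel cylDensity cylEntropy truncL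
  hausdorffMeasure_sphere_four_pos hausdorffMeasure_sphere_four_lt_top)
open LiminfDensityAlongGoodTimes AtomicQuantization

namespace LimitHeightUnique

section Flow

variable {M : Type} [TopologicalSpace M] [T2Space M] [SecondCountableTopology M]
  [ChartedSpace (EuclideanSpace ℝ (Fin 4)) M] [IsManifold (𝓡 4) ∞ M] [CompactSpace M]
  [MeasurableSpace M] [BorelSpace M] {F ν : ℝ → M → EuclideanSpace ℝ (Fin 6)} {T : ℝ}

/-- **Every limit height of points of good slices is an atom of weight `≥ vol(S⁴)`.**  Along a cylinder
flow with heights `≤ B`, let `t k ≥ T + 1` be good times (window dissipations `→ 0`) whose area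
measures `μH⁴ ⌊ M_{t_k}` converge weakly to a finite measure `μ` carried by the slab
`N ∩ {|z₅| ≤ B}` with the product property.  If `(F (t k) (x k))₅ → c`, then `vol(S⁴) ≤ μ {z₅ = c}`:
a subsequence of the centres converges in the compact slab to some `y₀` with `(y₀)₅ = c`, the slices
have unit lower density at their own points along it (`helper_liminfDensityAlongGoodTimes`), and
`helper_atomOfLiminfDensity` applies. [cite: Brakke1978, §3] -/
theorem sphere_le_measure_slice_of_tendsto (hF : IsCylinderMCF M F ν T) {B : ℝ}
    (hB : ∀ r, T ≤ r → ∀ x : M, |F r x 5| ≤ B) {t : ℕ → ℝ} (ht1 : ∀ k, T + 1 ≤ t k)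
    (hW : Tendsto (fun k => ∫⁻ r in Icc (t k - 1) (t k), ∫⁻ x, ENNReal.ofReal
      (‖deriv (fun s => F s x) r‖ ^ 2) ∂(Measure.comap (F r)
        (μH[4] : Measure (EuclideanSpace ℝ (Fin 6))))) atTop (𝓝 0))
    (μ : Measure (EuclideanSpace ℝ (Fin 6))) [IsFiniteMeasure μ]
    (hsupp : μ {z : EuclideanSpace ℝ (Fin 6) |
      ¬ (∑ i : Fin 5, z (Fin.castSucc i) ^ 2 = 1 ∧ |z 5| ≤ B)} = 0)
    (hprod : ∀ Φ : ℝ → ℝ, Continuous Φ → ∀ g : EuclideanSpace ℝ (Fin 5) → ℝ, Continuous g →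
      ∫ z, Φ (z 5) * g (truncL z) ∂μ =
        ((μH[4] (Metric.sphere (0 : EuclideanSpace ℝ (Fin 5)) 1)).toReal)⁻¹ *
          (∫ y in Metric.sphere (0 : EuclideanSpace ℝ (Fin 5)) 1, g y
            ∂(μH[4] : Measure (EuclideanSpace ℝ (Fin 5)))) * ∫ z, Φ (z 5) ∂μ)
    (hweak : ∀ g : BoundedContinuousFunction (EuclideanSpace ℝ (Fin 6)) ℝ,
      Tendsto (fun k => ∫ z in range (F (t k)), g z ∂(μH[4] : Measure (EuclideanSpace ℝ (Fin 6))))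
        atTop (𝓝 (∫ z, g z ∂μ)))
    {x : ℕ → M} {c : ℝ} (hc : Tendsto (fun k => F (t k) (x k) 5) atTop (𝓝 c)) :
    μH[4] (Metric.sphere (0 : EuclideanSpace ℝ (Fin 5)) 1) ≤
      μ {z : EuclideanSpace ℝ (Fin 6) | z 5 = c} := by
  have hTk : ∀ k, T ≤ t k := fun k => by linarith [ht1 k]
  -- Step 1: a converging subsequence of the centres `y k = F (t k) (x k)` in the compact slab
  obtain ⟨y₀, -, ψ, hψ, hy⟩ := (isCompact_cylinderSlab B).tendsto_subseq
    (x := fun k => F (t k) (x k)) fun k => ⟨hF.mem_cyl _ (hTk k) (x k), hB _ (hTk k) (x k)⟩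
  -- Step 2: its limit has height `c`
  have h5 : Continuous fun z : EuclideanSpace ℝ (Fin 6) => z 5 := PiLp.continuous_apply 2 _ 5
  have hy5 : Tendsto (fun k => F (t (ψ k)) (x (ψ k)) 5) atTop (𝓝 (y₀ 5)) := (h5.tendsto y₀).comp hy
  have hy₀ : y₀ 5 = c := tendsto_nhds_unique hy5 (hc.comp hψ.tendsto_atTop)
  -- Step 3: unit lower density of the slices at their own points, along the subsequence
  have hlim : ∀ τ : ℝ, 0 < τ → τ ≤ 1 → 1 ≤ liminf (fun k => cylDensity (range (F (t (ψ k))))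
      (F (t (ψ k)) (x (ψ k))) τ) atTop := fun τ hτ hτ1 =>
    helper_liminfDensityAlongGoodTimes M F ν T hF (fun k => t (ψ k)) (fun k => ht1 (ψ k))
      (hW.comp hψ.tendsto_atTop) (fun k => x (ψ k)) τ hτ hτ1
  -- Step 4: the atom at the limit height
  rw [← hy₀]
  exact helper_atomOfLiminfDensity M (fun k => F (t (ψ k))) (fun k => hF.isSmoothEmbedding _ (hTk _))
    (fun k w => hF.mem_cyl _ (hTk _) w) B (fun k w => hB _ (hTk _) w) μ hsupp hprod
    (fun g => (hweak g).comp hψ.tendsto_atTop) (fun k => F (t (ψ k)) (x (ψ k))) y₀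
    (fun k => hF.mem_cyl _ (hTk _) _) hy hlim

end Flow

end LimitHeightUnique

open LimitHeightUnique

/-- **Registered helper `helper_limitHeightUnique` of line `killing-flux` (lead c4, relaxation up to
multiplicity, A4a).**  Along a smooth cylinder flow `IsCylinderMCF M F ν T` with thin slices
(`λ_cyl(M_t) < 2`, `t ≥ T`), for a monotone sequence of good times `t k ≥ T + 1` (window dissipations
and slice energies `→ 0`) two sequences of points of the slices cannot have different limit heights:
the areas decrease to `A < 2 vol(S⁴)` (dissipation budget, `measure_ratio_le_cylEntropy`), a
subsequence of the area measures converges weakly to a product measure `μ` of mass `A`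
(`helper_limitMeasureExists`, `helper_productTestLimit`, `helper_equidistribution`), every limit
height is an atom of `μ` of weight `≥ vol(S⁴)` (`helper_liminfDensityAlongGoodTimes`,
`helper_atomOfLiminfDensity`), and two distinct atoms would have mass `2 vol(S⁴) > A`.
[cite: Brakke1978, §3] -/
theorem helper_limitHeightUnique : ∀ (M : Type) [TopologicalSpace M] [T2Space M] [SecondCountableTopology M] [ChartedSpace (EuclideanSpace ℝ (Fin 4)) M] [IsManifold (𝓡 4) ∞ M] [CompactSpace M] [MeasurableSpace M] [BorelSpace M] (F : ℝ → M → EuclideanSpace ℝ (Fin 6)) (ν : ℝ → M → EuclideanSpace ℝ (Fin 6)) (T : ℝ), IsCylinderMCF M F ν T → (∀ t, T ≤ t → Literature.Geometry.Riemannian.SphericalCylinderEntropy.cylEntropy (Set.range (F t)) < 2) → ∀ (t : ℕ → ℝ), Monotone t → (∀ k, T + 1 ≤ t k) → Filter.Tendsto (fun k => ∫⁻ r in Set.Icc (t k - 1) (t k), ∫⁻ x, ENNReal.ofReal (‖deriv (fun s => F s x) r‖ ^ 2) ∂(Measure.comap (F r) (μH[4] : Measure (EuclideanSpace ℝ (Fin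 6))))) Filter.atTop (𝓝 0) → Filter.Tendsto (fun k => ∫⁻ x, ENNReal.ofReal (‖deriv (fun s => F s x) (t k)‖ ^ 2) ∂(Measure.comap (F (t k)) (μH[4] : Measure (EuclideanSpace ℝ (Fin 6))))) Filter.atTop (𝓝 0) → ∀ (x x' : ℕ → M) (c c' : ℝ), Filter.Tendsto (fun k => F (t k) (x k) 5) Filter.atTop (𝓝 c) → Filter.Tendsto (fun k => F (t k) (x' k) 5) Filter.atTop (𝓝 c') → c = c' := by
  intro M _ _ _ _ _ _ _ _ F ν T hF hthin t ht htT hW hE x x' c c' hc hc'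
  by_contra hne
  -- Step 0: the uniform height bound; all times are `≥ T`
  obtain ⟨B, hB⟩ := exists_abs_apply_five_le hF
  have hTk : ∀ k, T ≤ t k := fun k => by linarith [htT k]
  -- Step 1: the areas are antitone and converge to their infimum `A < 2 vol(S⁴)`
  have hanti : Antitone fun k => μH[4] (range (F (t k))) := fun k l hkl =>
    le_add_self.trans ((hF.of_le (hTk k)).dissipationBudget (ht hkl))
  set A : ℝ≥0∞ := ⨅ k, μH[4] (range (F (t k))) with hA
  have hAlim : Tendsto (fun k => μH[4] (range (F (t k)))) atTop (𝓝 A) := tendsto_atTop_iInf hanti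
  have hA2 : A < 2 * μH[4] (Metric.sphere (0 : EuclideanSpace ℝ (Fin 5)) 1) :=
    (iInf_le (fun k => μH[4] (range (F (t k)))) 0).trans_lt
      (hF.measure_range_lt_two_mul (hTk 0) (hthin _ (hTk 0)))
  have hAtop : A < ⊤ := hA2.trans_le le_top
  -- Step 2: eventually the areas are `< A + 1`; shift the sequences by `k₀`
  obtain ⟨k₀, hk₀⟩ := eventually_atTop.1
    (hAlim.eventually (gt_mem_nhds (ENNReal.lt_add_right hAtop.ne one_ne_zero)))
  -- Step 3: a weak limit `μ` of the area measures along a subsequence `φ` of the shifted slices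
  obtain ⟨φ, hφ, μ, hμ, hμA, hsupp, hweak⟩ := helper_limitMeasureExists M (fun k => F (t (k + k₀)))
    (fun k => hF.isSmoothEmbedding _ (hTk _)) (fun k w => hF.mem_cyl _ (hTk _) w) B
    (fun k w => hB _ (hTk _) w) A hAtop (fun k => (hk₀ (k + k₀) (Nat.le_add_left k₀ k)).le)
    (hAlim.comp (tendsto_add_atTop_nat k₀))
  haveI := hμ
  -- the combined reindexing `σ k = φ k + k₀` is strictly increasing
  have hσ : StrictMono fun k => φ k + k₀ := fun i j hij => Nat.add_lt_add_right (hφ hij) k₀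
  have hσT : Tendsto (fun k => φ k + k₀) atTop atTop := hσ.tendsto_atTop
  have hTσ : ∀ k, T ≤ t (φ k + k₀) := fun k => hTk _
  -- Step 4: the product property of `μ` (the slice energies are the Willmore energies, the
  -- product-test identities pass to the limit, equidistribution)
  have hE' : Tendsto (fun k => ∫⁻ w, ENNReal.ofReal (‖deriv (fun s => F s w) (t (φ k + k₀))‖ ^ 2)
      ∂(Measure.comap (F (t (φ k + k₀))) (μH[4] : Measure (EuclideanSpace ℝ (Fin 6))))) atTop (𝓝 0) :=
    hE.comp hσT
  have hH : Tendsto (fun k => ∫⁻ w, ENNReal.ofReal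
      ((euclideanMetric (EuclideanSpace ℝ (Fin 6))).meanCurvature (F (t (φ k + k₀)))
        contMDiff_pullbackBilin_holds (hF.isSpacelikeImmersion _ (hTσ k)) (ν (t (φ k + k₀))) w ^ 2)
      ∂(Measure.comap (F (t (φ k + k₀))) (μH[4] : Measure (EuclideanSpace ℝ (Fin 6))))) atTop (𝓝 0) :=
    hE'.congr fun k => lintegral_congr fun w => by rw [hF.norm_deriv_sq_eq (hTσ k) w]
  have hprodTest := helper_productTestLimit M (fun k => F (t (φ k + k₀))) (fun k => ν (t (φ k + k₀)))
    (fun k => hF.isSmoothEmbedding _ (hTσ k)) (fun k w => hF.mem_cyl _ (hTσ k) w)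
    (fun k => hF.isSpacelikeImmersion _ (hTσ k)) (fun k => hF.isUnitNormal _ (hTσ k))
    (fun k w => hF.normal_tangent _ (hTσ k) w) (fun k => hF.contMDiff_normal _ (hTσ k)) B
    (fun k w => hB _ (hTσ k) w) hH A hAtop (hAlim.comp hσT) μ hsupp hweak
  have hprod := helper_equidistribution B μ hsupp hprodTest
  -- Step 5: both limit heights are atoms of `μ` of weight `≥ vol(S⁴)`
  have hW' : Tendsto (fun k => ∫⁻ r in Icc (t (φ k + k₀) - 1) (t (φ k + k₀)), ∫⁻ w, ENNReal.ofReal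
      (‖deriv (fun s => F s w) r‖ ^ 2) ∂(Measure.comap (F r)
        (μH[4] : Measure (EuclideanSpace ℝ (Fin 6))))) atTop (𝓝 0) := hW.comp hσT
  have h1 := sphere_le_measure_slice_of_tendsto hF hB (t := fun k => t (φ k + k₀)) (fun k => htT _)
    hW' μ hsupp hprod hweak (x := fun k => x (φ k + k₀)) (hc.comp hσT)
  have h2 := sphere_le_measure_slice_of_tendsto hF hB (t := fun k => t (φ k + k₀)) (fun k => htT _)
    hW' μ hsupp hprod hweak (x := fun k => x' (φ k + k₀)) (hc'.comp hσT)
  -- Step 6: two disjoint atoms of weight `≥ vol(S⁴)` against the total mass `A < 2 vol(S⁴)`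
  have hdisj : Disjoint {z : EuclideanSpace ℝ (Fin 6) | z 5 = c} {z : EuclideanSpace ℝ (Fin 6) | z 5 = c'} :=
    Set.disjoint_left.2 fun z hz hz' => hne (hz.symm.trans hz')
  have hle : μH[4] (Metric.sphere (0 : EuclideanSpace ℝ (Fin 5)) 1) +
      μH[4] (Metric.sphere (0 : EuclideanSpace ℝ (Fin 5)) 1) ≤ A :=
    calc μH[4] (Metric.sphere (0 : EuclideanSpace ℝ (Fin 5)) 1) +
          μH[4] (Metric.sphere (0 : EuclideanSpace ℝ (Fin 5)) 1)
        ≤ μ {z : EuclideanSpace ℝ (Fin 6) | z 5 = c} + μ {z : EuclideanSpace ℝ (Fin 6) | z 5 = c'} :=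
          add_le_add h1 h2
      _ = μ ({z : EuclideanSpace ℝ (Fin 6) | z 5 = c} ∪ {z : EuclideanSpace ℝ (Fin 6) | z 5 = c'}) :=
          (measure_union hdisj (measurableSet_slice c')).symm
      _ ≤ μ univ := measure_mono (subset_univ _)
      _ = A := hμA
  rw [two_mul] at hA2
  exact absurd hA2 (not_lt.2 hle)

end Summit.SmoothPoincare4.SmoothPoincare4.Cruxes.CylinderRungTwo.KillingFlux

end
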